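import Summits.Ventures.HSemireg.WedgeHankelRecurrenceGaussChebyshevCRootsOfUnity
import Mathlib.RingTheory.RootsOfUnity.Complex

/-!
# Venture HSemireg — **THE UNIFORM REAL FACTORISATIONS OF THE LEVEL SETS: `C_n − 2 = ∏_{j<n} (X − 2cos(2πj∕n))`, `C_n + 2 = ∏_{j<n} (X − 2cos((2j+1)π∕n))` over `ℝ` (and `ℂ`), hence
# `(C_n − 2).roots = {2cos(2πj∕n) : j < n}`, `(C_n + 2).roots = {2cos((2j+1)π∕n) : j < n}` as multisets WITHOUT parity split** (`n ≥ 1`; each interior value is listed twice, `j` and `n − j`,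
# which is the double root of N502) — obtained from the roots-of-unity factorisation N507 at `ζ = e^{2πi∕n}`, `ξ = e^{πi∕n}` and descent `ℝ[X] ↪ ℂ[X]`

HONEST FRAMING. Part of the Lean index of the computation cell `pub-hsemireg` (seat p10 gen 49, Sunday typer «UNIFORM-IN-n»).  Polynomial algebra over `ℝ ⊂ ℂ` and `Complex.exp` only; no
variety, no cohomology theory, no sheaf, no Ext group and no semiregularity map is constructed here; nothing here says that HC / HC_CM / HC_AV holds; no Literature fact (unproved `Prop`) is
declared or used.  Custodian versions as in `WedgeHankelSiegelIdeal` (1/3).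
SOURCES (cited).  R. Lidl, G. L. Mullen, G. Turnwald, *Dickson Polynomials* (1993), Thm 3.12; T. J. Rivlin, *The Chebyshev Polynomials* (1974), §1.2; W. Watkins, J. Zeitlin, Amer. Math. Monthly 100
(1993) 471–474 (`∏ (x − 2cos(2πj∕n))` and the minimal polynomial of `2cos(2π∕n)`).
PROOF TYPED HERE.  N507 `chebyshevC_sub_two_eq_prod_of_isPrimitiveRoot` ∕ `chebyshevC_add_two_eq_prod_of_isPrimitiveRoot` over `ℂ` with Mathlib `Complex.isPrimitiveRoot_exp`; the factor
values `ζʲ + ζ⁻ʲ = 2cos(2πj∕n)` by `Complex.exp_nat_mul`, `Complex.exp_neg`, `Complex.two_cos`; descent to `ℝ[X]` by `Polynomial.map_injective` (`ℝ → ℂ` injective) and `Polynomial.Chebyshev.map_C`;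
roots by Mathlib `roots_multiset_prod_X_sub_C`.
DEDUP DISCLOSURE (`rg -n 'prod_cos|roots_of_unity|exp_units' Summits/Ventures/HSemireg/WedgeHankelRecurrence*`, `lean search`, 2026-09-04): N502 gives the parity-split multisets, N332-type leaves
the `T`-node products; the uniform `j < n` products below are not in the tree; 0 hits for the 7 names below.

WHAT IS IN THE TREE.  N507; Mathlib `Complex.isPrimitiveRoot_exp`, `Complex.two_cos`, `Complex.ofReal_cos`, `Polynomial.map_injective`, `Polynomial.Chebyshev.map_C`, `roots_multiset_prod_X_sub_C`.
THIS FILE (namespace `Summit.Ventures.HSemireg.Wedge.HankelOuter` continued; CHAINED on N507; 0 definitions):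
* §1273 `exp_units_pow_add_inv` (`ζʲ + ζ⁻ʲ = 2cos(jθ)` for `ζ = e^{iθ}`), **`chebyshevC_sub_two_eq_prod_cos_complex`**, **`chebyshevC_sub_two_eq_prod_cos_real`**, **`chebyshevC_sub_two_roots_real`**,
  **`chebyshevC_add_two_eq_prod_cos_complex`**, **`chebyshevC_add_two_eq_prod_cos_real`**, **`chebyshevC_add_two_roots_real`**.
CAVEATS.  `n ≥ 1`.  Nothing Ext-side.  New names only.
-/

open Module Polynomial
open scoped Matrix Polynomial

namespace Summit.Ventures.HSemireg.Wedge.HankelOuter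

/-! ## §1273. `C_n ∓ 2 = ∏_{j<n} (X − 2cos(…))` uniformly -/

/-- For `ζ = e^{iθ} ∈ ℂˣ`: **`ζʲ + (ζʲ)⁻¹ = 2cos(jθ)`**. [bookkeeping; this file, §1273] -/
theorem exp_units_pow_add_inv (θ : ℝ) (j : ℕ) :
    (((Units.mk0 (Complex.exp (θ * Complex.I)) (Complex.exp_ne_zero _)) ^ j : ℂˣ) : ℂ) + (((Units.mk0 (Complex.exp (θ * Complex.I)) (Complex.exp_ne_zero _)) ^ j)⁻¹ : ℂˣ) =
      ((2 * Real.cos (j * θ) : ℝ) : ℂ) := by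
  rw [Units.val_inv_eq_inv_val, Units.val_pow_eq_pow_val, Units.val_mk0, ← Complex.exp_nat_mul, ← Complex.exp_neg, Complex.ofReal_mul, Complex.ofReal_ofNat, Complex.ofReal_cos,
    Complex.two_cos, Complex.ofReal_mul, Complex.ofReal_natCast]
  ring_nf

/-- **`C_n − 2 = ∏_{j<n} (X − 2cos(2πj∕n))` in `ℂ[X]`** (`n ≥ 1`). [Lidl–Mullen–Turnwald Thm 3.12; this file, §1273] -/
theorem chebyshevC_sub_two_eq_prod_cos_complex {n : ℕ} (hn : n ≠ 0) :
    Polynomial.Chebyshev.C ℂ (n : ℤ) - 2 = ∏ j ∈ Finset.range n, (Polynomial.X - Polynomial.C (((2 * Real.cos (j * (2 * Real.pi / n)) : ℝ) : ℂ))) := by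
  set ζ : ℂˣ := Units.mk0 (Complex.exp ((2 * Real.pi / n : ℝ) * Complex.I)) (Complex.exp_ne_zero _) with hζdef
  have hζ : IsPrimitiveRoot ζ n := by
    rw [← IsPrimitiveRoot.coe_units_iff, hζdef, Units.val_mk0, show (((2 * Real.pi / n : ℝ)) : ℂ) * Complex.I = 2 * Real.pi * Complex.I / n by push_cast; ring]
    exact Complex.isPrimitiveRoot_exp n hn
  rw [chebyshevC_sub_two_eq_prod_of_isPrimitiveRoot (Nat.pos_of_ne_zero hn) hζ]
  refine Finset.prod_congr rfl fun j _ => ?_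
  rw [hζdef, exp_units_pow_add_inv]

/-- **`C_n − 2 = ∏_{j<n} (X − 2cos(2πj∕n))` in `ℝ[X]`** (`n ≥ 1`; each interior root appears for `j` and for `n − j`). [Watkins–Zeitlin 1993; this file, §1273] -/
theorem chebyshevC_sub_two_eq_prod_cos_real {n : ℕ} (hn : n ≠ 0) :
    Polynomial.Chebyshev.C ℝ (n : ℤ) - 2 = ∏ j ∈ Finset.range n, (Polynomial.X - Polynomial.C (2 * Real.cos (j * (2 * Real.pi / n)))) := by
  apply Polynomial.map_injective (algebraMap ℝ ℂ) (RingHom.injective _)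
  rw [Polynomial.map_sub, Polynomial.Chebyshev.map_C, Polynomial.map_ofNat, chebyshevC_sub_two_eq_prod_cos_complex hn, Polynomial.map_prod]
  refine Finset.prod_congr rfl fun j _ => ?_
  rw [Polynomial.map_sub, Polynomial.map_X, Polynomial.map_C]
  rfl

/-- **`(C_n − 2).roots = {2cos(2πj∕n) : j < n}` over `ℝ`** (`n ≥ 1`, multiset — the interior values occur twice). [Watkins–Zeitlin 1993; this file, §1273] -/
theorem chebyshevC_sub_two_roots_real {n : ℕ} (hn : n ≠ 0) :
    (Polynomial.Chebyshev.C ℝ (n : ℤ) - 2).roots = (Multiset.range n).map fun j : ℕ => 2 * Real.cos (j * (2 * Real.pi / n)) := by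
  have h : (Multiset.range n).map (fun j : ℕ => Polynomial.X - Polynomial.C (2 * Real.cos (j * (2 * Real.pi / n)))) =
      ((Multiset.range n).map fun j : ℕ => 2 * Real.cos (j * (2 * Real.pi / n))).map (fun a : ℝ => Polynomial.X - Polynomial.C a) := by rw [Multiset.map_map]; rfl
  rw [chebyshevC_sub_two_eq_prod_cos_real hn, Finset.prod_eq_multiset_prod, Finset.range_val, h, roots_multiset_prod_X_sub_C]

/-- **`C_n + 2 = ∏_{j<n} (X − 2cos((2j+1)π∕n))` in `ℂ[X]`** (`n ≥ 1`). [Lidl–Mullen–Turnwald Thm 3.12; this file, §1273] -/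
theorem chebyshevC_add_two_eq_prod_cos_complex {n : ℕ} (hn : n ≠ 0) :
    Polynomial.Chebyshev.C ℂ (n : ℤ) + 2 = ∏ j ∈ Finset.range n, (Polynomial.X - Polynomial.C (((2 * Real.cos ((2 * j + 1 : ℕ) * (Real.pi / n)) : ℝ) : ℂ))) := by
  set ξ : ℂˣ := Units.mk0 (Complex.exp ((Real.pi / n : ℝ) * Complex.I)) (Complex.exp_ne_zero _) with hξdef
  have hξ : IsPrimitiveRoot ξ (2 * n) := by
    rw [← IsPrimitiveRoot.coe_units_iff, hξdef, Units.val_mk0,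
      show (((Real.pi / n : ℝ)) : ℂ) * Complex.I = 2 * Real.pi * Complex.I / ((2 * n : ℕ) : ℂ) by push_cast; field_simp]
    exact Complex.isPrimitiveRoot_exp (2 * n) (by omega)
  rw [chebyshevC_add_two_eq_prod_of_isPrimitiveRoot (Nat.pos_of_ne_zero hn) hξ]
  refine Finset.prod_congr rfl fun j _ => ?_
  rw [hξdef, exp_units_pow_add_inv]

/-- **`C_n + 2 = ∏_{j<n} (X − 2cos((2j+1)π∕n))` in `ℝ[X]`** (`n ≥ 1`). [Watkins–Zeitlin 1993; this file, §1273] -/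
theorem chebyshevC_add_two_eq_prod_cos_real {n : ℕ} (hn : n ≠ 0) :
    Polynomial.Chebyshev.C ℝ (n : ℤ) + 2 = ∏ j ∈ Finset.range n, (Polynomial.X - Polynomial.C (2 * Real.cos ((2 * j + 1 : ℕ) * (Real.pi / n)))) := by
  apply Polynomial.map_injective (algebraMap ℝ ℂ) (RingHom.injective _)
  rw [Polynomial.map_add, Polynomial.Chebyshev.map_C, Polynomial.map_ofNat, chebyshevC_add_two_eq_prod_cos_complex hn, Polynomial.map_prod]
  refine Finset.prod_congr rfl fun j _ => ?_
  rw [Polynomial.map_sub, Polynomial.map_X, Polynomial.map_C]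
  rfl

/-- **`(C_n + 2).roots = {2cos((2j+1)π∕n) : j < n}` over `ℝ`** (`n ≥ 1`, multiset). [Watkins–Zeitlin 1993; this file, §1273] -/
theorem chebyshevC_add_two_roots_real {n : ℕ} (hn : n ≠ 0) :
    (Polynomial.Chebyshev.C ℝ (n : ℤ) + 2).roots = (Multiset.range n).map fun j : ℕ => 2 * Real.cos ((2 * j + 1 : ℕ) * (Real.pi / n)) := by
  have h : (Multiset.range n).map (fun j : ℕ => Polynomial.X - Polynomial.C (2 * Real.cos ((2 * j + 1 : ℕ) * (Real.pi / n)))) =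
      ((Multiset.range n).map fun j : ℕ => 2 * Real.cos ((2 * j + 1 : ℕ) * (Real.pi / n))).map (fun a : ℝ => Polynomial.X - Polynomial.C a) := by rw [Multiset.map_map]; rfl
  rw [chebyshevC_add_two_eq_prod_cos_real hn, Finset.prod_eq_multiset_prod, Finset.range_val, h, roots_multiset_prod_X_sub_C]

end Summit.Ventures.HSemireg.Wedge.HankelOuter
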